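/-
Copyright (c) 2026 the pub-hodgecm-mathlib formalisation cell (harness21).  Prover seat hodgecm-mathlib-A-p19 (g27), 2026-09-01.  Road «S3-tree»∕«S3-ram» (LEAD F0P3a-plan (g12)
T11-41∕T11-52; owner p06 (g15)), row (e2) «P-2-ram», organ «[T2-a]-ram»: ★ F0P3b-p01 (g12)'s torsor count `CyclicSelfDualLatticeTorsor` at a TAMELY RAMIFIED place — the three
`hnorm`-theorems re-proved privately, hypothesis-driven in the self-dual-locus dictionary, and the public rank-3 head at a ramified CM∕quadratic place over ★ `UnitaryGroupSelfDualLocusRamifiedThree`.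
-/
import Literature.NumberTheory.Automorphic.CyclicSelfDualLatticeTorsor             -- ★ [T2-a] p846576 F0P3b-p01 (g12): §1 cyclic lattices, `exists_units_of_mem`, `span_eq_span_iff_inv_mul_mem_units`, `mem_units_of_map_span_eq`, `map_span_eq_self_of_map_span_mul_eq`, `formCongr_eq_mul_of_adjoint`, `formCongr_mul_of_mem_unitary`, …
import Literature.NumberTheory.Automorphic.UnitaryGroupSelfDualLocusRamifiedThree    -- ★ p847116 (this seat): `exists_mem_unitaryGroupOfForm_mul_iff_of_ramified_three`
import HarnessLib

/-!
# Self-dual cyclic lattices of a regular element are a torsor, at a TAMELY RAMIFIED place: `#{Λ self-dual, Λ = ⊕ 𝒪·τ^j w} = [C : R^×]`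
# (Jacobowitz 1962 §7–§8; Serre, *Trees* II §1.1; Rogawski 1990 §4.9 Lemma 4.9.3)

Topic `NumberTheory/Automorphic`; namespace `Literature.NumberTheory.Automorphic`.  THEOREMS ONLY (no definition, no instance, no notation, no named fact, no `sorry`).
Cell `pub/hodgecm-mathlib` (D-0151), crux H413 = `stmt-HodgeConjecture-24833`; road «S3-tree», seeding wave «S3-ram» (tame-ramified non-split `v ∤ 2`), row (e2) «P-2-ram» (the
type-(2) share of `stub_levelOneRowsRam`); organ **«[T2-a]-ram»** (this seat; consumer: the R2²-ram one-place row of A-p12 (g23)'s STUB A₂, together with ★ p847126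
`TypeTwoOrderNormUnitIndexRamifiedBase` (F0P3a-p08 (g19): the index `[C : R^×]`) and ★ p847100 ∕ `RationalCyclicSelfDualLatticesOfLocus` (this seat: which class is good)).
HONEST LABEL: HC_CM is proved only modulo the 2 remaining named inputs (hLiu418 24832, h413 24833) until rung 0 closes; elementary lattice algebra, asserts nothing printed.

WHAT CHANGES w.r.t. ★ `CyclicSelfDualLatticeTorsor` (F0P3b-p01 (g12)).  Its three docking theorems `good_mul_of_mem_comap`, `mul_inv_mem_comap_of_good_of_good`,
`ncard_setOf_selfDual_cyclic_eq_relIndex` dock on ★ `exists_mem_unitary_span_eq_iff_selfDual` (`FixedCosetsStableLattices`), i.e. on ★ L1 through Jacobowitz's INERT binders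
(trace) `b + σb = 1`, (norm) «every `σ`-fixed unit is a norm» — the latter false at a ramified place.  §1 re-proves them VERBATIM (privately: same conclusions, weaker hypotheses)
with those binders replaced by the lattice-level DICTIONARY `hL1Λ : ∀ Λ, (∃ u ∈ U(σ,J), Λ = Λ(u)) ↔ ∃ g, ((σg)ᵀ J g ∈ GL_n(𝒪)) ∧ Λ = Λ(g)`; §2 discharges `hL1Λ` in rank `3` at a tamely
ramified non-split place of a quadratic extension of number fields from ★ `exists_mem_unitaryGroupOfForm_mul_iff_of_ramified_three` and states the public head.  Everything
else (§1 of ★: Krylov frames, `𝒪[τ]`-stability, `exists_units_of_mem`, the fibre lemma `span_eq_span_iff_inv_mul_mem_units`, ★ (c1) `natCard_range_eq_relIndex_of_fibres`) is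
imported, not restated.

* §1 (private) `good_mul_of_mem_comap_of_locus`, `mul_inv_mem_comap_of_good_of_good_of_locus`, `ncard_setOf_selfDual_cyclic_eq_relIndex_of_locus`.
* §2 **`ncard_setOf_selfDual_cyclic_eq_relIndex_of_ramified`** — at `w ∣ v` non-split (`c • w = w`, `c ≠ 1`), RAMIFIED (`e(w|v) ≠ 1`), tame (`2 ∈ 𝒪_w^×`), for a
  `σ_w`-hermitian `J ∈ GL₃(𝒪_w)` and a regular integral `τ ∈ M₃(E_w)` with cyclic vector `w₀` and commutant algebra `φ : B → M₃(E_w)` (★'s abstract carrier): if some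
  `b₀ ∈ Bˣ` is good then `#{Λ | (∃ u ∈ U(σ_w,J), Λ = Λ(u)) ∧ ∃ w, Λ = ⊕ 𝒪·τ^j w} = [C : R_B^×]`, `C = {c : c c⋆ ∈ R_B^×}` — the letter of ★ [T2-a] at a ramified place.

## References
* [Jacobowitz1962] R. Jacobowitz, *Hermitian forms over local fields*, Amer. J. Math. 84 (1962), §7 Thm. 7.1, §8.
* [Serre1980Trees] J.-P. Serre, *Trees* (1980), Ch. II §1.1 (lattice classes and their stabilisers).
* [Rogawski1990] J. D. Rogawski, *Automorphic Representations of Unitary Groups in Three Variables* (1990), §4.9 Lemma 4.9.3 p. 56.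
-/

set_option autoImplicit false

noncomputable section

open Matrix Polynomial NumberField IsDedekindDomain
open scoped MatrixGroups ValuativeRel

namespace Literature.NumberTheory.Automorphic

open Literature.NumberTheory.Automorphic.UnitaryGroup

/-! ## §1 The torsor, hypothesis-driven in the self-dual-locus dictionary (private re-cuts of ★ [T2-a]) -/

section Locus

variable {E : Type*} [Field E] [ValuativeRel E] {n : ℕ} (σ : E →+* E)
  {B : Type*} [CommRing B] [Algebra E B]
  (hσO : ∀ x : 𝒪[E], σ x ∈ 𝒪[E])
  (J : GL (Fin n) E) (hJ : J ∈ glInt n E)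
  (hL1Λ : ∀ Λ : Submodule 𝒪[E] (Fin n → E),
    (∃ u ∈ unitaryGroupOfForm σ (J : Matrix (Fin n) (Fin n) E), Λ = Submodule.span 𝒪[E] (Set.range ((u : Matrix (Fin n) (Fin n) E))ᵀ)) ↔
      ∃ g : GL (Fin n) E, (∃ J' ∈ glInt n E, (J' : Matrix (Fin n) (Fin n) E) = formCongr σ g (J : Matrix (Fin n) (Fin n) E)) ∧
        Λ = Submodule.span 𝒪[E] (Set.range ((g : Matrix (Fin n) (Fin n) E))ᵀ))
  (τ : Matrix (Fin n) (Fin n) E) (hint : ∀ i, τ.charpoly.coeff i ∈ 𝒪[E]) {w₀ : Fin n → E}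
  (hK : IsUnit (Matrix.of fun i j : Fin n => ((τ ^ (j : ℕ)) *ᵥ w₀) i).det)
  (φ : B →ₐ[E] Matrix (Fin n) (Fin n) E) (hφ : Function.Injective φ) (τB : B) (hτB : φ τB = τ)
  (star : B →+* B) (hstar : ∀ b, (J : Matrix (Fin n) (Fin n) E) * φ (star b) = ((φ b).map σ)ᵀ * J)
  (RB : Subring B) (hRB : ∀ x, x ∈ Algebra.adjoin 𝒪[E] ({τ} : Set (Matrix (Fin n) (Fin n) E)) ↔ ∃ b ∈ RB, φ b = x)

include hJ hint hτB hstar hRB hL1Λ in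
/-- **C-STABILITY OF THE GOOD ELEMENTS**: if `L(φ(b) w₀)` is self-dual and `c c⋆ ∈ R_B^×` then `L(φ(c b) w₀)` is self-dual — its Gram matrix in the frame `φ(c)·u` is
`J·(u⁻¹ ρ u)`, `ρ = φ(c c⋆)`, and `u⁻¹ρu ∈ GL_n(𝒪)` since `ρ` stabilises the `𝒪[τ]`-module `Λ(u)` (docking through the dictionary `hL1Λ`). [cite: Jacobowitz1962, §7 Thm. 7.1]
[cite: Serre1980Trees, Ch. II §1.1] -/
private theorem good_mul_of_mem_comap_of_locus (b c : Bˣ)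
    (hb : ∃ u ∈ unitaryGroupOfForm σ (J : Matrix (Fin n) (Fin n) E),
      Submodule.span 𝒪[E] (Set.range fun j : Fin n => (τ ^ (j : ℕ)) *ᵥ (φ (b : B) *ᵥ w₀)) = Submodule.span 𝒪[E] (Set.range ((u : Matrix (Fin n) (Fin n) E))ᵀ))
    (hc : c ∈ (RB.toSubmonoid.units).comap (MonoidHom.id Bˣ * (Units.map (star : B →+* B).toMonoidHom))) :
    ∃ u ∈ unitaryGroupOfForm σ (J : Matrix (Fin n) (Fin n) E),
      Submodule.span 𝒪[E] (Set.range fun j : Fin n => (τ ^ (j : ℕ)) *ᵥ (φ ((c * b : Bˣ) : B) *ᵥ w₀)) = Submodule.span 𝒪[E] (Set.range ((u : Matrix (Fin n) (Fin n) E))ᵀ) := by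
  obtain ⟨u, hu, huL'⟩ := hb
  have huL := huL'.symm
  rw [Subgroup.mem_comap] at hc
  set ρ : Bˣ := (MonoidHom.id Bˣ * (Units.map (star : B →+* B).toMonoidHom)) c with hρdef
  have hρval : (ρ : B) = c * star c := by
    rw [hρdef, MonoidHom.mul_apply, MonoidHom.id_apply, Units.val_mul, Units.coe_map]; rfl
  set cu : GL (Fin n) E := Units.map (φ : B →* Matrix (Fin n) (Fin n) E) c with hcu
  set ρu : GL (Fin n) E := Units.map (φ : B →* Matrix (Fin n) (Fin n) E) ρ with hρu
  have hcu_val : (cu : Matrix (Fin n) (Fin n) E) = φ (c : B) := by rw [hcu, Units.coe_map, MonoidHom.coe_coe]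
  have hρu_val : (ρu : Matrix (Fin n) (Fin n) E) = φ (ρ : B) := by rw [hρu, Units.coe_map, MonoidHom.coe_coe]
  -- the new lattice is `Λ(cu * u)`
  have hnew : Submodule.span 𝒪[E] (Set.range fun j : Fin n => (τ ^ (j : ℕ)) *ᵥ (φ ((c * b : Bˣ) : B) *ᵥ w₀)) =
      Submodule.span 𝒪[E] (Set.range (((cu * u : GL (Fin n) E) : Matrix (Fin n) (Fin n) E))ᵀ) := by
    rw [Units.val_mul, map_mul, ← Matrix.mulVec_mulVec, ← map_span_range_pow_mulVec_of_commute τ (φ (c : B)) (commute_map_of_eq τ φ τB hτB _),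
      ← huL, Units.val_mul, span_range_transpose_mul, hcu_val]
  -- `ρ` stabilises `Λ(u) = L(φ b w₀)`, so `u⁻¹ ρu u ∈ GL_n(𝒪)`
  have hstab : Submodule.span 𝒪[E] (Set.range ((u : Matrix (Fin n) (Fin n) E))ᵀ) =
      Submodule.span 𝒪[E] (Set.range (((ρu * u : GL (Fin n) E) : Matrix (Fin n) (Fin n) E))ᵀ) := by
    rw [Units.val_mul, span_range_transpose_mul, huL, hρu_val, map_span_range_pow_mulVec_eq_of_mem_units τ hint φ RB hRB ρ hc]
  have hk : u⁻¹ * (ρu * u) ∈ glInt n E := (span_range_transpose_eq_iff u (ρu * u)).1 hstab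
  -- the Gram matrix of `cu * u` is `J · u⁻¹ ρu u`
  have hgram : formCongr σ (cu * u) (J : Matrix (Fin n) (Fin n) E) = (((J * (u⁻¹ * (ρu * u)) : GL (Fin n) E)) : Matrix (Fin n) (Fin n) E) := by
    rw [formCongr_mul_eq_formCongr_formCongr, hcu, formCongr_eq_mul_of_adjoint σ J φ star hstar c, mul_comm (star (c : B)) _, ← hρval, ← hρu_val,
      formCongr_mul_of_mem_unitary σ J hu]
    simp only [Units.val_mul, Matrix.mul_assoc]
  -- docking through `hL1Λ`
  refine (hL1Λ _).2 ⟨cu * u, ⟨J * (u⁻¹ * (ρu * u)), mul_mem hJ hk, hgram.symm⟩, hnew⟩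

include hσO hJ hint hK hφ hτB hstar hRB hL1Λ in
/-- **TRANSITIVITY: two good elements differ by an element of `C`** — if `L(φ(b₀) w₀)` and `L(φ(b₁) w₀)` are both self-dual then `N(b₁ b₀⁻¹) = (b₁b₀⁻¹)(b₁b₀⁻¹)⋆ ∈ R_B^×`:
with `c = b₁b₀⁻¹`, `Λ(u₁) = φ(c)·Λ(u₀)`, so the Gram matrix `J·u₀⁻¹ρu₀` of `φ(c)u₀` (`ρ = φ(N c)`) is unimodular (★ `exists_mem_glInt_coe_eq_formCongr`), `ρ` stabilises
`Λ(u₀) = φ(b₀)·L(w₀)`, hence `L(w₀)`, hence `ρ^{±1} ∈ 𝒪[τ]`. [cite: Jacobowitz1962, §7] [cite: Serre1980Trees, Ch. II §1.1] -/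
private theorem mul_inv_mem_comap_of_good_of_good_of_locus (b₀ b₁ : Bˣ)
    (hb₀ : ∃ u ∈ unitaryGroupOfForm σ (J : Matrix (Fin n) (Fin n) E),
      Submodule.span 𝒪[E] (Set.range fun j : Fin n => (τ ^ (j : ℕ)) *ᵥ (φ (b₀ : B) *ᵥ w₀)) = Submodule.span 𝒪[E] (Set.range ((u : Matrix (Fin n) (Fin n) E))ᵀ))
    (hb₁ : ∃ u ∈ unitaryGroupOfForm σ (J : Matrix (Fin n) (Fin n) E),
      Submodule.span 𝒪[E] (Set.range fun j : Fin n => (τ ^ (j : ℕ)) *ᵥ (φ (b₁ : B) *ᵥ w₀)) = Submodule.span 𝒪[E] (Set.range ((u : Matrix (Fin n) (Fin n) E))ᵀ)) :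
    b₁ * b₀⁻¹ ∈ (RB.toSubmonoid.units).comap (MonoidHom.id Bˣ * (Units.map (star : B →+* B).toMonoidHom)) := by
  obtain ⟨u₀, hu₀, hL₀⟩ := hb₀
  obtain ⟨u₁, hu₁, hL₁⟩ := hb₁
  set c : Bˣ := b₁ * b₀⁻¹ with hcdef
  rw [Subgroup.mem_comap]
  set ρ : Bˣ := (MonoidHom.id Bˣ * (Units.map (star : B →+* B).toMonoidHom)) c with hρdef
  have hρval : (ρ : B) = c * star c := by
    rw [hρdef, MonoidHom.mul_apply, MonoidHom.id_apply, Units.val_mul, Units.coe_map]; rfl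
  set cu : GL (Fin n) E := Units.map (φ : B →* Matrix (Fin n) (Fin n) E) c with hcu
  set ρu : GL (Fin n) E := Units.map (φ : B →* Matrix (Fin n) (Fin n) E) ρ with hρu
  have hcu_val : (cu : Matrix (Fin n) (Fin n) E) = φ (c : B) := by rw [hcu, Units.coe_map, MonoidHom.coe_coe]
  have hρu_val : (ρu : Matrix (Fin n) (Fin n) E) = φ (ρ : B) := by rw [hρu, Units.coe_map, MonoidHom.coe_coe]
  -- `Λ(cu * u₀) = Λ(u₁)`
  have hb₁c : (b₁ : B) = c * b₀ := by rw [hcdef, Units.val_mul, Units.inv_mul_cancel_right]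
  have hΛ : Submodule.span 𝒪[E] (Set.range (((cu * u₀ : GL (Fin n) E) : Matrix (Fin n) (Fin n) E))ᵀ) =
      Submodule.span 𝒪[E] (Set.range ((u₁ : Matrix (Fin n) (Fin n) E))ᵀ) := by
    rw [Units.val_mul, span_range_transpose_mul, hcu_val, ← hL₀, map_span_range_pow_mulVec_of_commute τ (φ (c : B)) (commute_map_of_eq τ φ τB hτB _),
      ← hL₁, hb₁c, map_mul, ← Matrix.mulVec_mulVec]
  -- the Gram matrix of `cu * u₀` is unimodular (★ docking at `Λ(u₁)`), and equals `J · u₀⁻¹ ρu u₀`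
  obtain ⟨g, ⟨J', hJ', hJ'g⟩, hΛg⟩ := (hL1Λ _).1 ⟨u₁, hu₁, rfl⟩
  have hk : (cu * u₀)⁻¹ * g ∈ glInt n E := (span_range_transpose_eq_iff (cu * u₀) g).1 (hΛ.trans hΛg)
  obtain ⟨J'', hJ'', hJ''e⟩ := exists_mem_glInt_coe_eq_formCongr σ hσO J' hJ' ((cu * u₀)⁻¹ * g)⁻¹ (inv_mem hk)
  have hgram : formCongr σ (cu * u₀) (J : Matrix (Fin n) (Fin n) E) = (((J * (u₀⁻¹ * (ρu * u₀)) : GL (Fin n) E)) : Matrix (Fin n) (Fin n) E) := by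
    rw [formCongr_mul_eq_formCongr_formCongr, hcu, formCongr_eq_mul_of_adjoint σ J φ star hstar c, mul_comm (star (c : B)) _, ← hρval, ← hρu_val,
      formCongr_mul_of_mem_unitary σ J hu₀]
    simp only [Units.val_mul, Matrix.mul_assoc]
  have hgram' : formCongr σ (cu * u₀) (J : Matrix (Fin n) (Fin n) E) = (J'' : Matrix (Fin n) (Fin n) E) := by
    rw [hJ''e, hJ'g, ← formCongr_mul_eq_formCongr_formCongr, _root_.mul_inv_rev, inv_inv, mul_inv_cancel_left]
  have hX : J * (u₀⁻¹ * (ρu * u₀)) = J'' := Units.ext (hgram.symm.trans hgram')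
  have hXint : u₀⁻¹ * (ρu * u₀) ∈ glInt n E := by
    have h : J⁻¹ * J'' ∈ glInt n E := mul_mem (inv_mem hJ) hJ''
    rwa [← hX, inv_mul_cancel_left] at h
  -- so `ρ` stabilises `Λ(u₀) = L(φ b₀ w₀)`, hence `L(w₀)`
  have hstabΛ : Submodule.span 𝒪[E] (Set.range ((u₀ : Matrix (Fin n) (Fin n) E))ᵀ) =
      Submodule.span 𝒪[E] (Set.range (((ρu * u₀ : GL (Fin n) E) : Matrix (Fin n) (Fin n) E))ᵀ) := (span_range_transpose_eq_iff u₀ (ρu * u₀)).2 hXint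
  have hstab₀ : (Submodule.span 𝒪[E] (Set.range fun j : Fin n => (τ ^ (j : ℕ)) *ᵥ (φ (b₀ : B) *ᵥ w₀))).map
      ((Matrix.toLin' (φ (ρ : B))).restrictScalars 𝒪[E]) = Submodule.span 𝒪[E] (Set.range fun j : Fin n => (τ ^ (j : ℕ)) *ᵥ (φ (b₀ : B) *ᵥ w₀)) := by
    rw [hL₀, ← hρu_val, ← span_range_transpose_mul, ← Units.val_mul]
    exact hstabΛ.symm
  exact mem_units_of_map_span_eq τ hint hK φ hφ τB hτB RB hRB ρ (map_span_eq_self_of_map_span_mul_eq τ φ τB hτB b₀ (ρ : B) hstab₀)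

include hσO hJ hint hK hφ hτB hstar hRB hL1Λ in
/-- **THE COUNT `[C : R_B^×]`** (organ [T2-a]): if SOME `b₀ ∈ Bˣ` is good (`L(φ(b₀) w₀)` self-dual), then the self-dual cyclic lattices of `τ` — the ★ rider's set
`{Λ | (∃ u ∈ U(σ,J), Λ = Λ(u)) ∧ ∃ w, Λ = ⊕_{j<n} 𝒪·τ^j w}` of ★ `ncard_fixedBy_unitary_rank_eq_ncard_free'` — number `R_B^×.relIndex C`, `C = {c ∈ Bˣ : c c⋆ ∈ R_B^×}`
(`Subgroup.comap` of `R_B^× = R_B.toSubmonoid.units` under `id · (⋆ on units)`); ★ (c1) `natCard_range_eq_relIndex_of_fibres` on `c ↦ L(φ(c b₀) w₀)`.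
[cite: Jacobowitz1962, §7] [cite: Serre1980Trees, Ch. II §1.1] [cite: Rogawski1990, §4.9 Lemma 4.9.3 p. 56] -/
private theorem ncard_setOf_selfDual_cyclic_eq_relIndex_of_locus (b₀ : Bˣ)
    (hb₀ : ∃ u ∈ unitaryGroupOfForm σ (J : Matrix (Fin n) (Fin n) E),
      Submodule.span 𝒪[E] (Set.range fun j : Fin n => (τ ^ (j : ℕ)) *ᵥ (φ (b₀ : B) *ᵥ w₀)) = Submodule.span 𝒪[E] (Set.range ((u : Matrix (Fin n) (Fin n) E))ᵀ)) :
    {Λ : Submodule 𝒪[E] (Fin n → E) |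
        (∃ u ∈ unitaryGroupOfForm σ (J : Matrix (Fin n) (Fin n) E), Λ = Submodule.span 𝒪[E] (Set.range ((u : Matrix (Fin n) (Fin n) E))ᵀ)) ∧
          ∃ w : Fin n → E, Λ = Submodule.span 𝒪[E] (Set.range fun j : Fin n => (τ ^ (j : ℕ)) *ᵥ w)}.ncard =
      (RB.toSubmonoid.units).relIndex ((RB.toSubmonoid.units).comap (MonoidHom.id Bˣ * (Units.map (star : B →+* B).toMonoidHom))) := by
  set C : Subgroup Bˣ := (RB.toSubmonoid.units).comap (MonoidHom.id Bˣ * (Units.map (star : B →+* B).toMonoidHom)) with hC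
  let f : C → Submodule 𝒪[E] (Fin n → E) := fun c => Submodule.span 𝒪[E] (Set.range fun j : Fin n => (τ ^ (j : ℕ)) *ᵥ (φ (((c : Bˣ) * b₀ : Bˣ) : B) *ᵥ w₀))
  have hS : {Λ : Submodule 𝒪[E] (Fin n → E) |
        (∃ u ∈ unitaryGroupOfForm σ (J : Matrix (Fin n) (Fin n) E), Λ = Submodule.span 𝒪[E] (Set.range ((u : Matrix (Fin n) (Fin n) E))ᵀ)) ∧
          ∃ w : Fin n → E, Λ = Submodule.span 𝒪[E] (Set.range fun j : Fin n => (τ ^ (j : ℕ)) *ᵥ w)} = Set.range f := by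
    ext Λ
    constructor
    · intro hΛ
      obtain ⟨b, hbgood, rfl⟩ := exists_units_of_mem σ J τ hK φ hφ τB hτB hΛ
      have hc : b * b₀⁻¹ ∈ C := mul_inv_mem_comap_of_good_of_good_of_locus σ hσO J hJ hL1Λ τ hint hK φ hφ τB hτB star hstar RB hRB b₀ b hb₀ hbgood
      refine ⟨⟨b * b₀⁻¹, hc⟩, ?_⟩
      show Submodule.span 𝒪[E] (Set.range fun j : Fin n => (τ ^ (j : ℕ)) *ᵥ (φ (((b * b₀⁻¹) * b₀ : Bˣ) : B) *ᵥ w₀)) = _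
      rw [inv_mul_cancel_right]
    · rintro ⟨c, rfl⟩
      obtain ⟨u, hu, h⟩ := good_mul_of_mem_comap_of_locus σ J hJ hL1Λ τ hint φ τB hτB star hstar RB hRB b₀ (c : Bˣ) hb₀ c.2
      exact ⟨⟨u, hu, h⟩, _, rfl⟩
  rw [hS, ← Nat.card_coe_set_eq]
  exact Literature.GroupTheory.natCard_range_eq_relIndex_of_fibres C (RB.toSubmonoid.units) f fun c c' =>
    span_eq_span_iff_inv_mul_mem_units τ hint hK φ hφ τB hτB RB hRB b₀ (c : Bˣ) (c' : Bˣ)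


end Locus

/-! ## §2 Rank three at a tamely ramified non-split place of a quadratic extension of number fields -/

section Ramified

variable {F E : Type} [Field F] [NumberField F] [Field E] [NumberField E] [Algebra F E]
  [Algebra.IsQuadraticExtension F E] (c : E ≃ₐ[F] E) {v : HeightOneSpectrum (𝓞 F)} (w : UnitaryGroup.PlacesOver E v)

/-- **[T2-a] AT A TAMELY RAMIFIED PLACE — THE COUNT `[C : R_B^×]` OF SELF-DUAL `τ`-CYCLIC LATTICES.**  At a non-split place `w ∣ v` (`c • w = w`, `c ≠ 1`) that is RAMIFIED
(`e(w|v) ≠ 1`) and tame (`2 ∈ 𝒪_w^×`), with `σ_w = galAdicCompletionMap c hw`, a `σ_w`-hermitian `J ∈ GL₃(𝒪_w)`, and ★ [T2-a]'s abstract carrier (`τ` integral with cyclic vector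
`w₀`, commutant algebra `φ : B → M₃(E_w)` with adjoint `⋆`, order `R_B = φ⁻¹𝒪[τ]`): if SOME `b₀ ∈ Bˣ` is good (`L(φ(b₀) w₀)` self-dual) then the self-dual `τ`-cyclic lattices — the
★ rider's set — number `R_B^×.relIndex C`, `C = {c : c c⋆ ∈ R_B^×}`.  §1 with the dictionary supplied by ★ `exists_mem_unitaryGroupOfForm_mul_iff_of_ramified_three`.
[cite: Jacobowitz1962, §7 Thm. 7.1, §8] [cite: Serre1980Trees, Ch. II §1.1] [cite: Rogawski1990, §4.9 Lemma 4.9.3 p. 56] -/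
theorem ncard_setOf_selfDual_cyclic_eq_relIndex_of_ramified (hc1 : c ≠ 1) (hw : c • w.1 = w.1)
    (he : v.asIdeal.ramificationIdx' w.1.asIdeal ≠ 1) (h2 : IsUnit (2 : 𝒪[w.1.adicCompletion E]))
    {B : Type*} [CommRing B] [Algebra (w.1.adicCompletion E) B]
    (J : GL (Fin 3) (w.1.adicCompletion E)) (hJ : J ∈ glInt 3 (w.1.adicCompletion E))
    (hJh : ((J : Matrix (Fin 3) (Fin 3) (w.1.adicCompletion E)).map (galAdicCompletionMap (L := E) c hw))ᵀ = J)
    (τ : Matrix (Fin 3) (Fin 3) (w.1.adicCompletion E)) (hint : ∀ i, τ.charpoly.coeff i ∈ 𝒪[w.1.adicCompletion E]) {w₀ : Fin 3 → w.1.adicCompletion E}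
    (hK : IsUnit (Matrix.of fun i j : Fin 3 => ((τ ^ (j : ℕ)) *ᵥ w₀) i).det)
    (φ : B →ₐ[w.1.adicCompletion E] Matrix (Fin 3) (Fin 3) (w.1.adicCompletion E)) (hφ : Function.Injective φ) (τB : B) (hτB : φ τB = τ)
    (star : B →+* B)
    (hstar : ∀ b, (J : Matrix (Fin 3) (Fin 3) (w.1.adicCompletion E)) * φ (star b) = ((φ b).map (galAdicCompletionMap (L := E) c hw))ᵀ * J)
    (RB : Subring B) (hRB : ∀ x, x ∈ Algebra.adjoin 𝒪[w.1.adicCompletion E] ({τ} : Set (Matrix (Fin 3) (Fin 3) (w.1.adicCompletion E))) ↔ ∃ b ∈ RB, φ b = x)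
    (b₀ : Bˣ)
    (hb₀ : ∃ u ∈ unitaryGroupOfForm (galAdicCompletionMap (L := E) c hw) (J : Matrix (Fin 3) (Fin 3) (w.1.adicCompletion E)),
      Submodule.span 𝒪[w.1.adicCompletion E] (Set.range fun j : Fin 3 => (τ ^ (j : ℕ)) *ᵥ (φ (b₀ : B) *ᵥ w₀)) =
        Submodule.span 𝒪[w.1.adicCompletion E] (Set.range ((u : Matrix (Fin 3) (Fin 3) (w.1.adicCompletion E)))ᵀ)) :
    {Λ : Submodule 𝒪[w.1.adicCompletion E] (Fin 3 → w.1.adicCompletion E) |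
        (∃ u ∈ unitaryGroupOfForm (galAdicCompletionMap (L := E) c hw) (J : Matrix (Fin 3) (Fin 3) (w.1.adicCompletion E)),
            Λ = Submodule.span 𝒪[w.1.adicCompletion E] (Set.range ((u : Matrix (Fin 3) (Fin 3) (w.1.adicCompletion E)))ᵀ)) ∧
          ∃ w' : Fin 3 → w.1.adicCompletion E, Λ = Submodule.span 𝒪[w.1.adicCompletion E] (Set.range fun j : Fin 3 => (τ ^ (j : ℕ)) *ᵥ w')}.ncard =
      (RB.toSubmonoid.units).relIndex ((RB.toSubmonoid.units).comap (MonoidHom.id Bˣ * (Units.map (star : B →+* B).toMonoidHom))) := by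
  have hσO : ∀ x : 𝒪[w.1.adicCompletion E], galAdicCompletionMap (L := E) c hw x ∈ 𝒪[w.1.adicCompletion E] := fun x =>
    mem_integer_galAdicCompletionMap c v w hw x
  have hL1Λ : ∀ Λ : Submodule 𝒪[w.1.adicCompletion E] (Fin 3 → w.1.adicCompletion E),
      (∃ u ∈ unitaryGroupOfForm (galAdicCompletionMap (L := E) c hw) (J : Matrix (Fin 3) (Fin 3) (w.1.adicCompletion E)),
          Λ = Submodule.span 𝒪[w.1.adicCompletion E] (Set.range ((u : Matrix (Fin 3) (Fin 3) (w.1.adicCompletion E)))ᵀ)) ↔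
        ∃ g : GL (Fin 3) (w.1.adicCompletion E),
          (∃ J' ∈ glInt 3 (w.1.adicCompletion E), (J' : Matrix (Fin 3) (Fin 3) (w.1.adicCompletion E)) =
            formCongr (galAdicCompletionMap (L := E) c hw) g (J : Matrix (Fin 3) (Fin 3) (w.1.adicCompletion E))) ∧
          Λ = Submodule.span 𝒪[w.1.adicCompletion E] (Set.range ((g : Matrix (Fin 3) (Fin 3) (w.1.adicCompletion E)))ᵀ) := by
    intro Λ
    constructor
    · rintro ⟨u, hu, rfl⟩
      exact ⟨u, (exists_mem_unitaryGroupOfForm_mul_iff_of_ramified_three c w hc1 hw he h2 J hJ hJh u).1 ⟨u, hu, 1, one_mem _, (mul_one u).symm⟩, rfl⟩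
    · rintro ⟨g, hg, rfl⟩
      obtain ⟨u, hu, k, hk, rfl⟩ := (exists_mem_unitaryGroupOfForm_mul_iff_of_ramified_three c w hc1 hw he h2 J hJ hJh g).2 hg
      refine ⟨u, hu, ?_⟩
      rw [eq_comm, span_range_transpose_eq_iff, inv_mul_cancel_left]
      exact hk
  exact ncard_setOf_selfDual_cyclic_eq_relIndex_of_locus (galAdicCompletionMap (L := E) c hw) hσO J hJ hL1Λ τ hint hK φ hφ τB hτB star hstar RB hRB b₀ hb₀

end Ramified

end Literature.NumberTheory.Automorphic

end
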